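import Literature.AlgebraicGeometry.Frobenioids.PadicKummerThm24iiLayer
import Literature.AlgebraicGeometry.Frobenioids.PadicKummerFNLayerNaturality
import HarnessLib

/-!
# Frobenioids II, Theorem 2.4 (ii) at the Galois binding: the assembly with the layer maps
# `F_N(Aᵢ) → H²(Γ_{Eᵢ}, μ_N)` (cell row W12, PIECE C′ = C instantiated at B)

Mochizuki, *The geometry of Frobenioids II*, Kyushu J. Math. **62** (2008) 401–460, §2, Theorem 2.4
(ii) p. 20 [cite: MochizukiFrdII2008, Thm 2.4 (ii) p.20]: "If the `Φᵢ` are fieldwise saturated, then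
the isomorphism `F_N(A₁) ⥲ F_N(A₂)` of (i) is compatible with the natural isomorphisms
`F_N(Aᵢ) ⥲ ℤ/Nℤ`"; proof p. 21 ("induced on subquotients" by the invariant of the layer field,
[AbsAnab] Prop. 1.2.1 (vii)).

PROOF-ONLY instantiation (abc-iut-L2-t12 g3) of abc-iut-w5-d201's generic assembly
`Def22Context.Iso.thm24ii_of_layerMaps` (PIECE C, `PadicKummerThm24iiLayer.lean`: any additive layer
maps `Θᵢ` natural along `e`) at the CONSTRUCTED layer maps `Θᵢ := Def22Context.fnLayerMap …` of
PIECE B (`PadicKummerFNLayerTransport.lean` / `…Naturality.lean`), for an isomorphism `e` of two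
Galois-level contexts `ofGalois Lᵢ Hᵢ hHᵢ resᵢ res_smulᵢ` (abc-iut-L1-t7) with models
`mᵢ : μ_N(Aᵢ) ≅ μ_N(K̄ᵢ)`:
* the hypothesis `hα` of PIECE C ("`α` carries `Gal(K̄₁/E₁⁰)` onto `Gal(K̄₂/E₂⁰)`") is AUTOMATIC for
  `α := e.isoG` (`galFixing_embField_iff_isoG`, from `e.map_H` and `Hᵢ = Gal(K̄ᵢ/Eᵢ⁰)`);
* the naturality hypothesis `hΘ` of PIECE C is PIECE B's `fnLayerMap_isoFN`, its `μ`-square input being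
  derived (`layerMuEquiv_square_of_units`) from the units-level square of PIECE A and the ONE remaining
  Frobenioid-side datum `hO`: "`Ψ` preserves `O^⊳(−)`" read on `N`-th roots of unity — the
  `μ_N`-isomorphism `e.muIso` induced by `e.isoO` IS `ψ̄` through the models `mᵢ`.
Result: **`thm24ii_ofGalois_layers`** — the typed `Thm24ii` for `e.thm24Data N` and invariants `invᵢ`
pinned to the residue maps of the layers through `fnLayerMap`, from: `ψ̄ : K̄₁ˣ ⥲ K̄₂ˣ`
`e.isoG`-equivariant with the [AbsAnab] Prop. 1.2.1 (iii)/(iv) properties (`PreservesAbsUnits`,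
`PreservesUniformizers`), `hO`, and the residue-map property of `inv_{Eᵢ}` (`IsInvariantMap`). With
`fnLayerMap_bijective_of_isNHSaturated` the pinned invariants EXIST for saturated objects
(`exists_fnInvariant_pinned`, PIECE C). Nothing here concerns [IUTchIII]; classical.
-/

noncomputable section

namespace Literature.AlgebraicGeometry.Frobenioids

namespace PadicKummer

namespace Def22Context.Iso

open Field IntermediateField Kummer
open Literature.NumberTheory.GaloisRepresentations
open Literature.NumberTheory.GaloisRepresentations.LocalWeilDatum
open Literature.NumberTheory.GaloisRepresentations.DiscreteGaloisModule
open Literature.AnabelianGeometry.AbsoluteAnabelian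
open Literature.AnabelianGeometry.AbsoluteAnabelian.Prop121vii

variable {K₁ K₂ : Type} [Field K₁] [ValuativeRel K₁] [TopologicalSpace K₁]
  [IsNonarchimedeanLocalField K₁] [CharZero K₁] [Field K₂] [ValuativeRel K₂] [TopologicalSpace K₂]
  [IsNonarchimedeanLocalField K₂] [CharZero K₂]
  {L₁ : IntermediateField K₁ (AlgebraicClosure K₁)} [Normal K₁ L₁] [FiniteDimensional K₁ L₁]
  {AutC₁ O₁ : Type} [Group AutC₁] [CommMonoid O₁] [IsCancelMul O₁] [MulDistribMulAction AutC₁ O₁]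
  [MulDistribMulAction (L₁ ≃ₐ[K₁] L₁) O₁] {H₁ : Subgroup (absoluteGaloisGroup K₁)} [H₁.Normal]
  {hH₁ : IsOpen (H₁ : Set (absoluteGaloisGroup K₁))} {res₁ : AutC₁ →* (L₁ ≃ₐ[K₁] L₁)}
  {res_smul₁ : ∀ (α : AutC₁) (x : O₁), res₁ α • x = α • x}
  {L₂ : IntermediateField K₂ (AlgebraicClosure K₂)} [Normal K₂ L₂] [FiniteDimensional K₂ L₂]
  {AutC₂ O₂ : Type} [Group AutC₂] [CommMonoid O₂] [IsCancelMul O₂] [MulDistribMulAction AutC₂ O₂]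
  [MulDistribMulAction (L₂ ≃ₐ[K₂] L₂) O₂] {H₂ : Subgroup (absoluteGaloisGroup K₂)} [H₂.Normal]
  {hH₂ : IsOpen (H₂ : Set (absoluteGaloisGroup K₂))} {res₂ : AutC₂ →* (L₂ ≃ₐ[K₂] L₂)}
  {res_smul₂ : ∀ (α : AutC₂) (x : O₂), res₂ α • x = α • x}
  (e : Iso (ofGalois L₁ H₁ hH₁ res₁ res_smul₁) (ofGalois L₂ H₂ hH₂ res₂ res_smul₂)) (N : ℕ) [NeZero N]
  (m₁ : MuModel L₁ O₁ N) (m₂ : MuModel L₂ O₂ N)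
  (E₁ : Type) [Field E₁] [Algebra K₁ E₁] [FiniteDimensional K₁ E₁] [Finite (MuCarrier E₁ N)]
  (hHE₁ : H₁ = galFixing K₁ (embField K₁ E₁))
  (E₂ : Type) [Field E₂] [Algebra K₂ E₂] [FiniteDimensional K₂ E₂] [Finite (MuCarrier E₂ N)]
  (hHE₂ : H₂ = galFixing K₂ (embField K₂ E₂))

include hHE₁ hHE₂ in
omit [ValuativeRel K₁] [TopologicalSpace K₁] [IsNonarchimedeanLocalField K₁] [CharZero K₁]
  [ValuativeRel K₂] [TopologicalSpace K₂] [IsNonarchimedeanLocalField K₂] [CharZero K₂]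
  [FiniteDimensional K₁ E₁] [Finite (MuCarrier E₁ N)] [FiniteDimensional K₂ E₂]
  [Finite (MuCarrier E₂ N)] [NeZero N] in
/-- The hypothesis `hα` of PIECE C is automatic for `α := e.isoG`: the context isomorphism maps
`H₁ = Gal(K̄₁/E₁⁰)` onto `H₂ = Gal(K̄₂/E₂⁰)` (`e.map_H`). [cite: MochizukiFrdII2008, Thm 2.4 (i) p.19] -/
theorem galFixing_embField_iff_isoG (g : absoluteGaloisGroup K₁) :
    g ∈ galFixing K₁ (embField K₁ E₁) ↔ e.isoG g ∈ galFixing K₂ (embField K₂ E₂) := by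
  rw [← hHE₁, ← hHE₂]
  exact (e.isoG_mem_H_iff g).symm

/-- **Theorem 2.4 (ii) at the Galois binding with the CONSTRUCTED layer identifications
`F_N(Aᵢ) → H²(Γ_{Eᵢ}, μ_N(Ēᵢ))`** (PIECE C of abc-iut-w5-d201 instantiated at PIECE B): for an
isomorphism `e` of Galois-level contexts, models `mᵢ`, layers `Eᵢ` with `Hᵢ = Gal(K̄ᵢ/Eᵢ⁰)`, a
`K̄`-level multiplicative isomorphism `ψ̄` which is `e.isoG`-equivariant, carries absolute units to
units and `K₁`-uniformisers to `K₂`-uniformisers ([AbsAnab] Prop. 1.2.1 (iii), (iv) — what `Ψ` induces,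
p. 21) AND restricts on `μ_N` to the isomorphism `e.muIso` induced by `e.isoO` through the models
(`hO`, "`Ψ` preserves `O^⊳(−)`"), and invariants `invᵢ` pinned to residue maps `inv_{Eᵢ}` of the layers
through `fnLayerMap`: "the isomorphism `F_N(A₁) ⥲ F_N(A₂)` of (i) is compatible with the natural
isomorphisms `F_N(Aᵢ) ⥲ ℤ/Nℤ`" — the typed `Thm24ii`. [cite: MochizukiFrdII2008, Thm 2.4 (ii) p.20] -/
theorem thm24ii_ofGalois_layers
    (ψ : (AlgebraicClosure K₁)ˣ ≃* (AlgebraicClosure K₂)ˣ) (hψ : IsAlphaEquivariant e.isoG ψ)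
    (hu : PreservesAbsUnits ψ) (hunif : PreservesUniformizers ψ)
    (hO : ∀ ζ : Mu N O₁,
      ((m₂.toMulEquiv (e.muIso N ζ) : rootsOfUnity N (AlgebraicClosure K₂)) : (AlgebraicClosure K₂)ˣ) =
        ψ ((m₁.toMulEquiv ζ : rootsOfUnity N (AlgebraicClosure K₁)) : (AlgebraicClosure K₁)ˣ))
    (invE₁ : galoisCohomology (mu E₁ N) 2 →+ ZMod N) (invE₂ : galoisCohomology (mu E₂ N) 2 →+ ZMod N)
    (fs₁ fs₂ : Prop) (inv₁ : FNInvariant (ofGalois L₁ H₁ hH₁ res₁ res_smul₁) N)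
    (inv₂ : FNInvariant (ofGalois L₂ H₂ hH₂ res₂ res_smul₂) N)
    (hpin₁ : ∀ x, inv₁.toAddEquiv x = invE₁ (fnLayerMap L₁ H₁ hH₁ res₁ res_smul₁ E₁ hHE₁ m₁ x))
    (hpin₂ : ∀ x, inv₂.toAddEquiv x = invE₂ (fnLayerMap L₂ H₂ hH₂ res₂ res_smul₂ E₂ hHE₂ m₂ x)) :
    letI := FiniteExtension.valuativeRel K₁ E₁
    letI := FiniteExtension.topologicalSpace K₁ E₁
    haveI := FiniteExtension.isNonarchimedeanLocalField K₁ E₁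
    letI := FiniteExtension.valuativeRel K₂ E₂
    letI := FiniteExtension.topologicalSpace K₂ E₂
    haveI := FiniteExtension.isNonarchimedeanLocalField K₂ E₂
    IsInvariantMap E₁ N invE₁ → IsInvariantMap E₂ N invE₂ →
      Thm24ii (ofGalois L₁ H₁ hH₁ res₁ res_smul₁) (ofGalois L₂ H₂ hH₂ res₂ res_smul₂) N fs₁ fs₂
        (e.thm24Data N) inv₁ inv₂ :=
  e.thm24ii_of_layerMaps N E₁ E₂ e.isoG (galFixing_embField_iff_isoG e E₁ hHE₁ E₂ hHE₂) ψ hψ hu hunif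
    (fnLayerMap L₁ H₁ hH₁ res₁ res_smul₁ E₁ hHE₁ m₁) (fnLayerMap L₂ H₂ hH₂ res₂ res_smul₂ E₂ hHE₂ m₂)
    (fun β ψE hβ hA hμ x =>
      fnLayerMap_isoFN e m₁ m₂ E₁ hHE₁ E₂ hHE₂ β ψE.toMonoidHom hμ hβ
        (layerMuEquiv_square_of_units e m₁ m₂ E₁ E₂ ψE.toMonoidHom ψ (fun y => hA y) hO) x)
    invE₁ invE₂ fs₁ fs₂ inv₁ inv₂ hpin₁ hpin₂

omit [ValuativeRel K₁] [TopologicalSpace K₁] [IsNonarchimedeanLocalField K₁] [NeZero N]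
  [Finite (MuCarrier E₁ N)] in
/-- **The pinned invariants exist for saturated objects**: if `A₁` is `(N, H₁)`-saturated, `fnLayerMap`
is bijective (PIECE B), so for any bijective residue map `inv_{E₁}` there is an `FNInvariant` pinned to
it (PIECE C's `exists_fnInvariant_pinned`). [cite: MochizukiFrdII2008, Thm 2.4 (ii) p.21] -/
theorem exists_fnInvariant_pinned_ofGalois (hc : IsNHSaturated (ofGalois L₁ H₁ hH₁ res₁ res_smul₁) N)
    (invE₁ : galoisCohomology (mu E₁ N) 2 →+ ZMod N) (hinvE : Function.Bijective invE₁) :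
    ∃ inv₁ : FNInvariant (ofGalois L₁ H₁ hH₁ res₁ res_smul₁) N,
      ∀ x, inv₁.toAddEquiv x = invE₁ (fnLayerMap L₁ H₁ hH₁ res₁ res_smul₁ E₁ hHE₁ m₁ x) :=
  exists_fnInvariant_pinned _
    (fnLayerMap_bijective_of_isNHSaturated L₁ H₁ hH₁ res₁ res_smul₁ E₁ hHE₁ m₁ hc) invE₁ hinvE

end Def22Context.Iso

end PadicKummer

end Literature.AlgebraicGeometry.Frobenioids

end
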